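import Mathlib.FieldTheory.Galois.Basic
import Mathlib.Algebra.Algebra.Rat
import Mathlib.GroupTheory.Perm.Cycle.Type
import HarnessLib

/-!
# The class-group facts of Monsky's Theorems 5.5 / 5.9 (1) from genus theory

Monsky, *Mock Heegner points and congruent numbers*, Math. Z. 204 (1990), proof of Thm 5.5 (p. 62): "In this
case, `m ∉ G²` and `⟨G², m⟩ = G_D`. So if `J ∈ G − G_D`, `φ = G² ∪ JG²` is a set of representatives for
`G/⟨m⟩`. … Now genus theory shows that `G²` contains an odd number of classes"; proof of Thm 5.9 (1)
(pp. 63–64): "`m ∉ G²` and `⟨G², m⟩ = G_N`. Fix `J ∈ G − G_N` … If `(p₅/p₇) = −1`, `G²` contains an odd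
number of classes"; Thm 4.7 (p. 57): an ambiguous class "neither principal nor `m`".

This file derives all of them, on an abstract finite abelian group `G` (the class group of `K = ℚ(√−2pq)`)
with a homomorphism `art : G →* Aut(H/ℚ)`, from the genus theory of `K` as Tian prints it (Notations,
journal pp. 122–123): (i) the `2`-torsion `G[2] = {[𝔭_d] : d ∣ 2n} = {1, m, [𝔭_p], [𝔭_q]}`, (ii) "`s ∈ G²` iff
`σ_s` fixes `√p` and `√−q`" (`2G = Gal(H/H₀)`), the ideal relation `m = [𝔭_p][𝔭_q]`, and the values of the
genus rule on the ramified classes (`GenusFieldGaloisData`): `σ_{[𝔭_p]}` fixes `√p`, moves `√−q`;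
`σ_{[𝔭_q]}` moves `√p` and fixes `√−q` iff `q ≡ 3 (8)`. Conclusions (`classGroupFacts_of_genusTheory`):

* `m ∉ G²`; `[𝔭_p]` is an ambiguous class `≠ 1, m` (Thm 4.7's `B`);
* `|G²|` is odd (no element of `G²` has order `2`, by (i) and the non-squares `m, [𝔭_p], [𝔭_q]`; Cauchy);
* with the second twist `θ′ = √p·√−q` (`q ≡ 3 (8)`) resp. `√−q` (`q ≡ 7 (8)`): `σ_t` fixes `θ′` iff
  `t ∈ G² ∪ mG²` ("`⟨G², m⟩ = G_D`"), and `J := [𝔭_p]` resp. `[𝔭_q]` moves `θ′` ("`J ∈ G − G_D`").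

Everything is fully proved; the inputs are printed sentences about the actual class field.

## References

* P. Monsky, Mock Heegner points and congruent numbers, Math. Z. 204 (1990) 45–67, Thm 4.7 proof (p. 57),
  Thm 5.5 proof (p. 62), Thm 5.9 (1) proof (pp. 63–64). [Monsky1990MockHeegner]
* Y. Tian, Congruent numbers and Heegner points, Camb. J. Math. 2 (2014) 117–161, Notations (pp. 122–123).
  [Tian2014]
-/

noncomputable section

namespace Literature.NumberTheory.EllipticCurves.Monsky1990

variable {G : Type*} [CommGroup G] {H : Type*} [Field H] [CharZero H]

/-- **`|G²|` is odd when `G²` has no element of order `2`** (Cauchy's theorem).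
[cite: Monsky1990MockHeegner, Thm 5.5 proof (p. 62: "genus theory shows that G² contains an odd number of classes")] -/
theorem odd_card_squares_of_forall [Fintype G] [DecidablePred (IsSquare : G → Prop)]
    (h : ∀ t : G, IsSquare t → t * t = 1 → t = 1) :
    Odd (Finset.univ.filter (IsSquare : G → Prop)).card := by
  classical
  by_contra hodd
  rw [Nat.not_odd_iff_even] at hodd
  -- the subgroup of squares
  let S : Subgroup G :=
    { carrier := {t | IsSquare t}
      mul_mem' := fun ha hb => IsSquare.mul ha hb
      one_mem' := ⟨1, (mul_one 1).symm⟩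
      inv_mem' := fun ha => ha.inv }
  have hmem : ∀ t : G, t ∈ S ↔ IsSquare t := fun t => Iff.rfl
  haveI : DecidablePred (· ∈ S) := fun t => decidable_of_iff (IsSquare t) (hmem t).symm
  have hcard : Fintype.card S = (Finset.univ.filter (IsSquare : G → Prop)).card := by
    rw [Fintype.card_subtype]
    congr 1
    ext t
    simp only [Finset.mem_filter, Finset.mem_univ, true_and, hmem]
  have h2 : 2 ∣ Fintype.card S := by
    rw [hcard]; exact even_iff_two_dvd.mp hodd
  haveI : Fact (Nat.Prime 2) := ⟨Nat.prime_two⟩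
  obtain ⟨x, hx⟩ := exists_prime_orderOf_dvd_card 2 h2
  have hx2 : x ^ 2 = 1 := by rw [← hx, pow_orderOf_eq_one]
  have hx1 : x ≠ 1 := by
    intro h1; rw [h1, orderOf_one] at hx; norm_num at hx
  apply hx1
  have hxG : (x : G) * (x : G) = 1 := by
    have := congrArg (Subtype.val) hx2
    simpa [sq] using this
  exact Subtype.ext (h x x.2 hxG)

/-- An automorphism sends a square root to `±` itself. [folklore] -/
private theorem map_eq_or_eq_neg (g : H ≃ₐ[ℚ] H) {s c : H} (hs : s ^ 2 = c) (hc : g c = c) :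
    g s = s ∨ g s = -s := by
  have : (g s) ^ 2 = s ^ 2 := by rw [← map_pow, hs, hc]
  exact sq_eq_sq_iff_eq_or_eq_neg.mp this

/-- **The class-group facts of Monsky's Thms 5.5 / 5.9 (1) from genus theory** (see the module docstring).
Hypotheses: `G` a finite abelian group with `art : G →* Aut(H/ℚ)`; `√p, √−q ∈ H` non-zero square roots of
`p`, `−q`; elements `cp, cq, m` with `m = cp·cq`, `cp² = cq² = 1`; (i) `G[2] ⊆ {1, m, cp, cq}`; (ii) `t` is a
square iff `σ_t` fixes `√p` and `√−q`; the genus-rule values `σ_{cp}√p = √p`, `σ_{cp}√−q = −√−q`,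
`σ_{cq}√p = −√p`, `σ_{cq}√−q = ±√−q` (`+` iff `q ≡ 3 (8)`).
[cite: Monsky1990MockHeegner, Thm 4.7 proof (p. 57), Thm 5.5 proof (p. 62), Thm 5.9 (1) proof (pp. 63–64)]
[cite: Tian2014, Notations (pp. 122–123)] -/
theorem classGroupFacts_of_genusTheory [Fintype G] [DecidablePred (IsSquare : G → Prop)]
    (art : G →* (H ≃ₐ[ℚ] H)) {p q : ℕ} {sqrtP sqrtNegQ : H} (hP : sqrtP ^ 2 = p) (hQ : sqrtNegQ ^ 2 = -q)
    (hsP : sqrtP ≠ 0) (hsQ : sqrtNegQ ≠ 0) {cp cq m : G} (hm : m = cp * cq) (hcp2 : cp * cp = 1)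
    (hcq2 : cq * cq = 1) (h2tor : ∀ t : G, t * t = 1 → t = 1 ∨ t = m ∨ t = cp ∨ t = cq)
    (hsq : ∀ t : G, IsSquare t ↔ (art t sqrtP = sqrtP ∧ art t sqrtNegQ = sqrtNegQ))
    (hcpP : art cp sqrtP = sqrtP) (hcpQ : art cp sqrtNegQ = -sqrtNegQ) (hcqP : art cq sqrtP = -sqrtP)
    (hcqQ : art cq sqrtNegQ = if q % 8 = 3 then sqrtNegQ else -sqrtNegQ) :
    ¬ IsSquare m ∧ Odd (Finset.univ.filter (IsSquare : G → Prop)).card ∧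
    (cp * cp = 1 ∧ cp ≠ 1 ∧ cp ≠ m) ∧
    (q % 8 = 3 →
      (∀ t : G, art t (sqrtP * sqrtNegQ) = sqrtP * sqrtNegQ ↔ (IsSquare t ∨ IsSquare (m * t))) ∧
      art cp (sqrtP * sqrtNegQ) ≠ sqrtP * sqrtNegQ) ∧
    (q % 8 = 7 →
      (∀ t : G, art t sqrtNegQ = sqrtNegQ ↔ (IsSquare t ∨ IsSquare (m * t))) ∧
      art cq sqrtNegQ ≠ sqrtNegQ) := by
  -- the actions of `σ_m`
  have hmP : art m sqrtP = -sqrtP := by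
    rw [hm, map_mul, AlgEquiv.mul_apply, hcqP, map_neg, hcpP]
  have hmQ : art m sqrtNegQ = if q % 8 = 3 then -sqrtNegQ else sqrtNegQ := by
    rw [hm, map_mul, AlgEquiv.mul_apply, hcqQ]
    by_cases h3 : q % 8 = 3
    · rw [if_pos h3, if_pos h3, hcpQ]
    · rw [if_neg h3, if_neg h3, map_neg, hcpQ, neg_neg]
  have hmm : m * m = 1 := by
    rw [hm, mul_mul_mul_comm, hcp2, hcq2, one_mul]
  -- the three non-squares
  have hneP : -sqrtP ≠ sqrtP := by
    intro h; apply hsP; linear_combination -(h / 2)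
  have hneQ : -sqrtNegQ ≠ sqrtNegQ := by
    intro h; apply hsQ; linear_combination -(h / 2)
  have hmsq : ¬ IsSquare m := fun h => hneP (by rw [← hmP]; exact ((hsq m).mp h).1)
  have hcpsq : ¬ IsSquare cp := fun h => hneQ (by rw [← hcpQ]; exact ((hsq cp).mp h).2)
  have hcqsq : ¬ IsSquare cq := fun h => hneP (by rw [← hcqP]; exact ((hsq cq).mp h).1)
  -- `|G²|` odd
  have hodd : Odd (Finset.univ.filter (IsSquare : G → Prop)).card := by
    apply odd_card_squares_of_forall
    intro t ht htt
    rcases h2tor t htt with h | h | h | h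
    · exact h
    · exact absurd (h ▸ ht) hmsq
    · exact absurd (h ▸ ht) hcpsq
    · exact absurd (h ▸ ht) hcqsq
  -- the ambiguous class `cp ≠ 1, m`
  have hcp1 : cp ≠ 1 := by
    intro h; apply hneQ; rw [← hcpQ, h, map_one, AlgEquiv.one_apply]
  have hcpm : cp ≠ m := by
    intro h; apply hneP; rw [← hmP, ← h, hcpP]
  -- `σ_t` sends `√p`, `√−q` to `±` themselves
  have hsignP : ∀ t, art t sqrtP = sqrtP ∨ art t sqrtP = -sqrtP :=
    fun t => map_eq_or_eq_neg (art t) hP (by rw [map_natCast])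
  have hsignQ : ∀ t, art t sqrtNegQ = sqrtNegQ ∨ art t sqrtNegQ = -sqrtNegQ :=
    fun t => map_eq_or_eq_neg (art t) hQ (by rw [map_neg, map_natCast])
  -- `σ_{mt} = σ_m ∘ σ_t` and `σ_t = σ_m ∘ σ_{mt}`
  have hmt : ∀ t : G, ∀ x : H, art (m * t) x = art m (art t x) := fun t x => by
    rw [map_mul, AlgEquiv.mul_apply]
  have htm : ∀ t : G, ∀ x : H, art t x = art m (art (m * t) x) := fun t x => by
    rw [← AlgEquiv.mul_apply, ← map_mul, ← mul_assoc, hmm, one_mul]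
  refine ⟨hmsq, hodd, ⟨hcp2, hcp1, hcpm⟩, ?_, ?_⟩
  · -- `q ≡ 3 (8)`, `θ′ = √p·√−q`
    intro h3
    rw [if_pos h3] at hmQ
    refine ⟨fun t => ⟨fun hfix => ?_, fun hsq' => ?_⟩, ?_⟩
    · rw [map_mul] at hfix
      rcases hsignP t with hp' | hp' <;> rcases hsignQ t with hq' | hq'
      · exact Or.inl ((hsq t).mpr ⟨hp', hq'⟩)
      · exfalso; rw [hp', hq'] at hfix
        exact hneQ (mul_left_cancel₀ hsP (by linear_combination hfix))
      · exfalso; rw [hp', hq'] at hfix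
        exact hneP (mul_right_cancel₀ hsQ (by linear_combination hfix))
      · right
        refine (hsq (m * t)).mpr ⟨?_, ?_⟩
        · rw [hmt, hp', map_neg, hmP, neg_neg]
        · rw [hmt, hq', map_neg, hmQ, neg_neg]
    · rcases hsq' with hs | hs
      · obtain ⟨hp', hq'⟩ := (hsq t).mp hs
        rw [map_mul, hp', hq']
      · obtain ⟨hp', hq'⟩ := (hsq (m * t)).mp hs
        rw [map_mul, htm t sqrtP, hp', hmP, htm t sqrtNegQ, hq', hmQ, neg_mul_neg]
    · rw [map_mul, hcpP, hcpQ, mul_neg]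
      intro h
      apply hneQ
      apply mul_left_cancel₀ hsP
      linear_combination h
  · -- `q ≡ 7 (8)`, `θ′ = √−q`
    intro h7
    have h3 : q % 8 ≠ 3 := by omega
    rw [if_neg h3] at hmQ hcqQ
    refine ⟨fun t => ⟨fun hfix => ?_, fun hsq' => ?_⟩, by rw [hcqQ]; exact hneQ⟩
    · rcases hsignP t with hp' | hp'
      · exact Or.inl ((hsq t).mpr ⟨hp', hfix⟩)
      · right
        refine (hsq (m * t)).mpr ⟨?_, ?_⟩
        · rw [hmt, hp', map_neg, hmP, neg_neg]
        · rw [hmt, hfix, hmQ]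
    · rcases hsq' with hs | hs
      · exact ((hsq t).mp hs).2
      · obtain ⟨-, hq'⟩ := (hsq (m * t)).mp hs
        rw [htm t sqrtNegQ, hq', hmQ]

end Literature.NumberTheory.EllipticCurves.Monsky1990

end
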